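/-
Copyright (c) 2026 the pub-hodgecm-mathlib formalisation cell (harness21).  Prover seat hodgecm-mathlib-K2Liu-p05 (g0): Track B «K2-LIT»,
#184♮ = hLiu418 = stmt-HodgeConjecture-24832; socket #32d `sig_K2LiuDoublingHeightDecayLocal` of `Cruxes/HLiu418/Lines/K2_Liu_CurveThetaSigs_U5d_ZetaS.lean`
(ED. 1 a836627a4002dcd3 :224) — the finite slice at a split place from the LOCAL torus decay in the doubled group; K2/STATUS 2026-09-04 (K2Liu-p05 (g0)).
-/
import Summits.HodgeConjecture.HodgeConjecture.Theorems.K2LiuSplitSliceCartanSeries            -- ★ `integrable_of_quasiInvariant_of_torusDecay`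
import Summits.HodgeConjecture.HodgeConjecture.Theorems.K2LiuDoublingSliceLocalBridge           -- ★ (T1) `iotaA_inclPlaceAdelic`
import Summits.HodgeConjecture.HodgeConjecture.Theorems.K2LiuDoublingSlicePlaceIdentity         -- ★ (T2) `iotaLeft_inclPlaceAdelic`
import Summits.HodgeConjecture.HodgeConjecture.Theorems.K2LiuPlacesEmbedMulSingle               -- ★ (A) `placesEmbed_one_mulSingle`
import Summits.HodgeConjecture.HodgeConjecture.Theorems.K2LiuDoublingHeightSliceQuasiInvariance -- ★ (A1) `exists_placeSlice_quasiBiInvariant`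
import Summits.HodgeConjecture.HodgeConjecture.Theorems.K2LiuDoublingUnfoldBridge               -- ★ H5 `exists_continuousMulEquiv_eq_iotaA`
import HarnessLib

/-!
# Crux `HLiu418`, road `K2_Liu`, unit U5d, socket #32d — THE FINITE SLICE FROM THE LOCAL TORUS DECAY (split place)

Cell `hodgecm-mathlib`, crux item hLiu418 = `stmt-HodgeConjecture-24832`; squad K2 ∕ K2Liu, LEAD F0P6-plan (g10), planner K2Liu-plan (g2), prover
K2Liu-p05 (g0).  THEOREMS ONLY (no `def` ∕ instance ∕ notation ∕ named-fact hypothesis ∕ `sorry`, default heartbeats); lane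
`--supports stmt-HodgeConjecture-24832 --as helper` (count-neutral).

THE STATEMENT (`integrable_placeSlice_of_localTorusDecay`).  In the frame of #32d (`L` CM, `V = ⟨diag dV⟩`, `W = ⟨diag dW⟩`, `ιA : U(H)(𝔸) →* U(diag dV)(𝔸)`
pinned by `hιA` along `ᵗ(c g)(t • H) g = diag dV`, a finite set `S`, a Haar measure `ν` on `G_v = U(H)(L⁺_v)`, a continuous height `Φ > 0` of type
`(P_Δ, modDelta)` on `H(𝔸)`), let `v ∈ S` and let `e′ : U(diag dV)(L⁺_v) ≃ₜ* GL_N(F)` be ANY isomorphism of topological groups onto `GL_N` of a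
non-archimedean local field `F` (uniformizer `ϖ`, residue cardinality `q`) with `GL_N(𝒪)` compact open.  IF the height decays along the torus of the
doubled group at `v`,
  `Φ(ι_v^H(ι_v(e′⁻¹ ϖ^a, 1))) ≤ C ∏_i r^{|a_i|}`  for all `a ∈ ℤ^N`, with `0 ≤ r`, `0 < τ` and `r^τ · q^{N−1} < 1`,
THEN the finite slice of #32d at `v` is integrable:
  `Integrable (fun u => Φ (iotaLeft L e dV hdV dW hdW (ιA (placesEmbed L H S (1, Pi.mulSingle v u)))) ^ τ) ν`
— i.e. EXACTLY the hypothesis `_hfin v` of ★ (R) `doublingHeightDecayLocal_of_slices`.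

THE PROOF (assembly of the organs landed for #32d).  With `κ_v = localCongr g⁻¹ … v : U(H)(L⁺_v) ≃ₜ* U(diag dV)(L⁺_v)` (★ «D5») and `E = e′ ∘ κ_v`:
(A) ★ `placesEmbed_one_mulSingle` + (T1) ★ `iotaA_inclPlaceAdelic` + (T2) ★ `iotaLeft_inclPlaceAdelic` turn the slice at `u = E⁻¹ ϖ^a` into
`Φ(ι_v^H(ι_v(e′⁻¹ ϖ^a, 1)))^τ`, so the hypothesis is the torus decay of `ψ = Φ(slice)^τ` with `s = r^τ`; (A1) ★ `exists_placeSlice_quasiBiInvariant` makes `ψ`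
quasi-bi-invariant under the compact open `K₀ = E⁻¹ GL_N(𝒪)`; and ★ `integrable_of_quasiInvariant_of_torusDecay` (Cartan decomposition through `E`, coset
counts (V), lattice sum (LT), Cartan bound (A2)) concludes.  For `r = q^{−1∕2}` the condition `r^τ q^{N−1} < 1` is `τ > 2N − 2`, the hypothesis of #32d;
the decay itself (organ (D)) is ★ `K2LiuSplitCartanIwasawa` + ★ `modDelta_locToAdelic` + ★ (EV) at a good split place (next file).

[GelbartPiatetskishapiroRallis1987, Part A §6]; [Li1992, §3 Thm. 3.1]; [Liu2011, §2C p. 863]; [Macdonald1995, Ch. V §2]; [PlatonovRapinchuk1994, §2.3].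
HONEST LABEL.  Count-neutral helper (the finite slice of #32d at a split place MODULO the local torus decay (D); (D) at good split places, the bad∕non-split
places and the archimedean slice remain): `HC_CM` is proved only modulo the 7 printed citations (2 remaining named inputs: hLiu418 =
`stmt-HodgeConjecture-24832`, h413 = `stmt-HodgeConjecture-24833`) until rung 0 closes.
-/

set_option autoImplicit false
-- the mandated namespace repeats the single-problem summit's segment (`HodgeConjecture.HodgeConjecture`)
set_option linter.dupNamespace false

noncomputable section

open scoped Matrix ENNReal
open NumberField IsDedekindDomain MeasureTheory

namespace Summit.HodgeConjecture.HodgeConjecture.Cruxes.HLiu418.K2LiuSplitSliceOfTorusDecay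

open Literature.NumberTheory.Automorphic Literature.NumberTheory.Automorphic.UnitaryGroup
open Literature.NumberTheory.GelbartRogawski1991 Literature.NumberTheory.GelbartRogawski1991.GRConstruction
open Literature.NumberTheory.K2Lit.SiegelDoubled Literature.NumberTheory.K2Lit.PlaceSplitting
open ValuativeRel
open Summit.HodgeConjecture.HodgeConjecture.Cruxes.HLiu418.K2LiuSplitSliceCartanSeries
open Summit.HodgeConjecture.HodgeConjecture.Cruxes.HLiu418.K2LiuDoublingSliceLocalBridge
open Summit.HodgeConjecture.HodgeConjecture.Cruxes.HLiu418.K2LiuDoublingSlicePlaceIdentity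
open Summit.HodgeConjecture.HodgeConjecture.Cruxes.HLiu418.K2LiuPlacesEmbedMulSingle
open Summit.HodgeConjecture.HodgeConjecture.Cruxes.HLiu418.K2LiuDoublingHeightSliceQuasiInvariance
open Summit.HodgeConjecture.HodgeConjecture.Cruxes.HLiu418.K2LiuDoublingUnfoldBridge

variable (L : Type) [Field L] [NumberField L] [IsCMField L]
variable {N M n : ℕ} (e : Fin N × Fin M ≃ Fin n)
  (dV : Fin N → L) (hdV : ∀ i, IsCMField.complexConj L (dV i) = dV i)
  (dW : Fin M → L) (hdW : ∀ i, IsCMField.complexConj L (dW i) = dW i)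
  (H : Matrix (Fin N) (Fin N) L) (t : L) (ht : t ≠ 0) (g : GL (Fin N) L)
  (hg : formCongr ((IsCMField.complexConj L : L ≃ₐ[↥(maximalRealSubfield L)] L) : L →+* L) g (t • H) = Matrix.diagonal dV)
  (ιA : (UnitaryGroup.adelicGroupData (Fp L) L (IsCMField.complexConj L) N H).Adelic →*
    UnitaryGroup.adelic (Fp L) L (IsCMField.complexConj L) N (Matrix.diagonal dV))
  (hιA : ∀ k, ((ιA k : ↥(UnitaryGroup.adelic (Fp L) L (IsCMField.complexConj L) N (Matrix.diagonal dV))) :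
        GL (Fin N) (AdeleRing (𝓞 L) L)) =
      (toAdeleGL L g)⁻¹ * UnitaryGroup.adelicVal (Fp L) L (IsCMField.complexConj L) N H k * toAdeleGL L g)
  (S : Finset (HeightOneSpectrum (𝓞 (Fp L)))) [DecidableEq (HeightOneSpectrum (𝓞 (Fp L)))]

/-! ## §1 The slice read through the bridges -/

include ht hg hιA in
/-- **the slice point through (A), (T1), (T2)**: `ι(ιA(placesEmbed_S(1, u at v)), 1) = ι_v^H(ι_v(κ_v u, 1))` in `H(𝔸)`.
[cite: Liu2011, §2C p. 863] [cite: PlatonovRapinchuk1994, §2.3] [cite: HarrisKudlaSweet1996, §1 (1.11)] -/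
theorem iotaLeft_iotaA_placesEmbed_mulSingle (v : S) (u : UnitaryGroup.localPi L (IsCMField.complexConj L) N H v.1) :
    iotaLeft L e dV hdV dW hdW (ιA (placesEmbed L H S (1, Pi.mulSingle v u))) =
      locToAdelic L e dV hdV dW hdW v.1 (iotaLeftLocPi L e dV hdV dW hdW v.1
        (localCongr L (IsCMField.complexConj L) g⁻¹ (inv_ne_zero ht) (formCongr_inv_inv_smul L H dV t ht g hg) v.1 u)) := by
  rw [placesEmbed_one_mulSingle L H S v u, iotaA_inclPlaceAdelic L H dV t ht g hg ιA hιA v.1 u]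
  exact iotaLeft_inclPlaceAdelic L e dV hdV dW hdW v.1 _

/-! ## §2 The finite slice from the local torus decay -/

include ht hg hιA in
/-- **THE FINITE SLICE OF #32d AT A SPLIT PLACE FROM THE LOCAL TORUS DECAY.**  See the module docstring.
[cite: GelbartPiatetskishapiroRallis1987, Part A §6] [cite: Li1992, §3 Thm. 3.1] [cite: Liu2011, §2C p. 863] [cite: Macdonald1995, Ch. V §2 (2.9)] -/
theorem integrable_placeSlice_of_localTorusDecay (hdV0 : ∀ i, dV i ≠ 0) (hdW0 : ∀ i, dW i ≠ 0) (v : S)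
    [MeasurableSpace (UnitaryGroup.localPi L (IsCMField.complexConj L) N H v.1)]
    [BorelSpace (UnitaryGroup.localPi L (IsCMField.complexConj L) N H v.1)]
    (ν : Measure (UnitaryGroup.localPi L (IsCMField.complexConj L) N H v.1)) [ν.IsHaarMeasure]
    {Φ : HA L e dV hdV dW hdW → ℝ} (hΦc : Continuous Φ) (hΦpos : ∀ x, 0 < Φ x)
    (hΦ : ∀ p x : HA L e dV hdV dW hdW, IsSiegelDelta L e dV hdV dW hdW p →
      Φ (p * x) = modDelta L e dV hdV dW hdW p * Φ x)
    -- the local split frame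
    {F : Type} [Field F] [ValuativeRel F] [TopologicalSpace F] [Finite 𝓀[F]] [IsDiscreteValuationRing 𝒪[F]] {ϖ : F}
    (hϖ : IsUniformizingElement ϖ) (e' : UnitaryGroup.localPi L (IsCMField.complexConj L) N (Matrix.diagonal dV) v.1 ≃ₜ* GL (Fin N) F)
    (hKo : IsOpen (glInt N F : Set (GL (Fin N) F))) (hKc : IsCompact (glInt N F : Set (GL (Fin N) F)))
    -- the torus decay in the doubled group at `v`
    {τ : ℝ} (hτ0 : 0 < τ) {C r : ℝ} (hr0 : 0 ≤ r) (hr1 : r ^ τ * (Nat.card 𝓀[F] : ℝ) ^ (N - 1) < 1)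
    (hdec : ∀ a : Fin N → ℤ,
      Φ (locToAdelic L e dV hdV dW hdW v.1 (iotaLeftLocPi L e dV hdV dW hdW v.1 (e'.symm (zpowDiagGL hϖ.ne_zero a)))) ≤
        C * ∏ i, r ^ (a i).natAbs) :
    Integrable (fun u => Φ (iotaLeft L e dV hdV dW hdW (ιA (placesEmbed L H S (1, Pi.mulSingle v u)))) ^ τ) ν := by
  -- the local congruence `κ_v` and the composite frame `E = e′ ∘ κ_v`
  set κ := localCongr L (IsCMField.complexConj L) g⁻¹ (inv_ne_zero ht) (formCongr_inv_inv_smul L H dV t ht g hg) v.1 with hκ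
  let E : UnitaryGroup.localPi L (IsCMField.complexConj L) N H v.1 ≃ₜ* GL (Fin N) F := κ.trans e'
  let K₀ : Subgroup (UnitaryGroup.localPi L (IsCMField.complexConj L) N H v.1) := (glInt N F).comap E.toMulEquiv.toMonoidHom
  have hK : ∀ x, E.toMulEquiv x ∈ glInt N F ↔ x ∈ K₀ := fun x => Iff.rfl
  have hK₀set : (K₀ : Set (UnitaryGroup.localPi L (IsCMField.complexConj L) N H v.1)) = E.toHomeomorph ⁻¹' (glInt N F : Set (GL (Fin N) F)) := rfl
  have hK₀o : IsOpen (K₀ : Set (UnitaryGroup.localPi L (IsCMField.complexConj L) N H v.1)) := by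
    rw [hK₀set]
    exact E.toHomeomorph.isOpen_preimage.2 hKo
  have hK₀c : IsCompact (K₀ : Set (UnitaryGroup.localPi L (IsCMField.complexConj L) N H v.1)) := by
    rw [hK₀set]
    exact E.toHomeomorph.isCompact_preimage.2 hKc
  -- continuity of `ιA` and of the slice
  obtain ⟨Ψ, -, hΨ⟩ := exists_continuousMulEquiv_eq_iotaA L H dV t ht g hg ιA hιA
  have hιc : Continuous ιA := by
    have h : (ιA : _ → _) = Ψ := funext fun x => (hΨ x).symm
    rw [h]
    exact Ψ.continuous
  have hslc : Continuous fun u : UnitaryGroup.localPi L (IsCMField.complexConj L) N H v.1 =>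
      iotaLeft L e dV hdV dW hdW (ιA (placesEmbed L H S (1, Pi.mulSingle v u))) :=
    (continuous_iotaLeft L e dV hdV dW hdW).comp (hιc.comp ((continuous_placesEmbed L H S).comp (continuous_const.prodMk
      (continuous_mulSingle (A := fun w : S => UnitaryGroup.localPi L (IsCMField.complexConj L) N H w.1) v))))
  have hψm : AEStronglyMeasurable
      (fun u => Φ (iotaLeft L e dV hdV dW hdW (ιA (placesEmbed L H S (1, Pi.mulSingle v u)))) ^ τ) ν :=
    ((hΦc.comp hslc).rpow_const fun x => Or.inl (hΦpos _).ne').aestronglyMeasurable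
  have hψ0 : ∀ u, 0 ≤ Φ (iotaLeft L e dV hdV dW hdW (ιA (placesEmbed L H S (1, Pi.mulSingle v u)))) ^ τ :=
    fun u => Real.rpow_nonneg (hΦpos _).le τ
  -- (A1): quasi-bi-invariance under the compact open `K₀`
  obtain ⟨c, hc, hcq⟩ := exists_placeSlice_quasiBiInvariant L e dV hdV dW hdW H ιA S hdV0 hdW0 hιc v hΦc hΦpos hΦ hK₀c hK₀c
  have hquasi : ∀ x ∈ K₀, ∀ y ∈ K₀, ∀ u : UnitaryGroup.localPi L (IsCMField.complexConj L) N H v.1,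
      Φ (iotaLeft L e dV hdV dW hdW (ιA (placesEmbed L H S (1, Pi.mulSingle v (x * u * y))))) ^ τ ≤
        c ^ τ * Φ (iotaLeft L e dV hdV dW hdW (ιA (placesEmbed L H S (1, Pi.mulSingle v u)))) ^ τ := by
    intro x hx y hy u
    rw [← Real.mul_rpow hc.le (hΦpos _).le]
    exact Real.rpow_le_rpow (hΦpos _).le (hcq u x hx y hy).1 hτ0.le
  -- the torus decay of `ψ = Φ(slice)^τ` through (A), (T1), (T2)
  have hC : 0 ≤ C := by
    have h := (hΦpos _).le.trans (hdec 0)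
    simp only [Pi.zero_apply, Int.natAbs_zero, pow_zero, Finset.prod_const_one, mul_one] at h
    exact h
  have hdecay : ∀ a : Fin N → ℤ,
      Φ (iotaLeft L e dV hdV dW hdW (ιA (placesEmbed L H S (1, Pi.mulSingle v (E.toMulEquiv.symm (zpowDiagGL hϖ.ne_zero a)))))) ^ τ ≤
        C ^ τ * ∏ i, (r ^ τ) ^ (a i).natAbs := by
    intro a
    have hpt : iotaLeft L e dV hdV dW hdW (ιA (placesEmbed L H S (1, Pi.mulSingle v (E.toMulEquiv.symm (zpowDiagGL hϖ.ne_zero a))))) =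
        locToAdelic L e dV hdV dW hdW v.1 (iotaLeftLocPi L e dV hdV dW hdW v.1 (e'.symm (zpowDiagGL hϖ.ne_zero a))) := by
      rw [iotaLeft_iotaA_placesEmbed_mulSingle L e dV hdV dW hdW H t ht g hg ιA hιA S v]
      show locToAdelic L e dV hdV dW hdW v.1 (iotaLeftLocPi L e dV hdV dW hdW v.1 (κ (κ.symm (e'.symm (zpowDiagGL hϖ.ne_zero a))))) = _
      rw [ContinuousMulEquiv.apply_symm_apply]
    rw [hpt]
    calc Φ (locToAdelic L e dV hdV dW hdW v.1 (iotaLeftLocPi L e dV hdV dW hdW v.1 (e'.symm (zpowDiagGL hϖ.ne_zero a)))) ^ τ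
        ≤ (C * ∏ i, r ^ (a i).natAbs) ^ τ := Real.rpow_le_rpow (hΦpos _).le (hdec a) hτ0.le
      _ = C ^ τ * ∏ i, (r ^ τ) ^ (a i).natAbs := by
          rw [Real.mul_rpow hC (Finset.prod_nonneg fun i _ => pow_nonneg hr0 _), ← Real.finsetProd_rpow _ _ fun i _ => pow_nonneg hr0 _]
          exact congrArg _ (Finset.prod_congr rfl fun i _ => (Real.rpow_pow_comm hr0 τ _).symm)
  -- the Cartan bound through `E`
  exact integrable_of_quasiInvariant_of_torusDecay hϖ ν E.toMulEquiv hK hK₀o hK₀c hψm hψ0 (Real.rpow_nonneg hc.le τ) hquasi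
    (Real.rpow_nonneg hr0 τ) hr1 hdecay

end Summit.HodgeConjecture.HodgeConjecture.Cruxes.HLiu418.K2LiuSplitSliceOfTorusDecay

end
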